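import Summits.QuantumAdvantage.QuantumAdvantage.Theorems.CharDialSegmentMovesD
import HarnessLib

/-!
# CharDial — segment moves, part E: the comb family is on the HIGH side of the variation dial

Support for `CharDial.WalkHardFJLinOdd` (stmt-QuantumAdvantage-32604), continuing part D.  Adjacent positions lie on DIFFERENT combs (`B ≥ 2`), an
adjacent swap of different bits moves the comb form of position `s` by `±1` (`combY_flip`), and every block holds `dialM n = 8 log₂ n + 9` full
residue systems (`card_cuts_comb_ge`), so `dialM n · 2ⁿ ≤ 2·swapMass (combY p n) s` at every position with a right neighbour (`swapMass_combY_ge`) and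
at most one position is low at threshold `4(log₂ n + 1)` (`not_low_combY`).  All statements Prop-free.
-/

set_option autoImplicit false

namespace Summit.QuantumAdvantage.AdviceFreeQNC0.JLinPeel.SegMove

open Finset
open Summit.QuantumAdvantage.AdviceFreeQNC0

variable {n : ℕ} {p : ℕ}

/-! #### HIGH side -/

/-- a firing comb cut flips under the adjacent swap at a position of its comb. -/
theorem combY_flip [hp : Fact p.Prime] (hB2 : 2 ≤ combB p n) (g : Fin (n + 1)) (u : Fin n → Bool) (s t : Fin n)
    (hst : t.val = s.val + 1) (hne : u s ≠ u t) (hgK : g.val / combK p n = s.val % combB p n)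
    (hgB : g.val < combB p n * combK p n)
    (hu : ((g : ℕ) : ZMod p) = form (combCoef p (combB p n) (s.val % combB p n)) u) :
    combY p n g (segCompl u s.val (s.val + 2)) ≠ combY p n g u := by
  haveI : Fact (1 < p) := ⟨hp.out.one_lt⟩
  have has : combCoef p (combB p n) (s.val % combB p n) s = 1 := by unfold combCoef; rw [if_pos rfl]
  have hat : combCoef p (combB p n) (s.val % combB p n) t = 0 := by
    unfold combCoef; rw [if_neg]; rw [hst]; exact succ_mod_ne hB2 s.val
  unfold combY
  rw [hgK, form_swap _ u s t hst hne, ← hu, has, hat]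
  rcases Bool.eq_false_or_eq_true (u s) with hus | hus
  · simp [hus, hgB]
  · simp [hus, hgB]

/-- block residue count: block `b < B` contains at least `dialM n` cuts of every residue. -/
theorem card_cuts_comb_ge [hp : Fact p.Prime] {b : ℕ} (hb : b < combB p n) (v : ZMod p) :
    dialM n ≤ (univ.filter fun g : Fin (n + 1) => g.val / combK p n = b ∧ ((g : ℕ) : ZMod p) = v).card := by
  haveI : NeZero p := ⟨hp.out.ne_zero⟩
  have hp0 : 0 < p := hp.out.pos
  set K := combK p n with hK
  set m := dialM n
  have hKm : K = p * m := rfl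
  have hK0 : 0 < K := combK_pos n
  have hBK := combB_mul_le p n
  have hv : v.val < p := ZMod.val_lt v
  have hbound : ∀ k : Fin m, K * b + (k.val * p + v.val) < n + 1 := by
    intro k
    have h1 : k.val * p + v.val < K := by
      have : (k.val + 1) * p ≤ m * p := Nat.mul_le_mul_right p (by have := k.isLt; omega)
      rw [hKm]; nlinarith
    have h2 : K * (b + 1) ≤ combB p n * K := by rw [mul_comm]; exact Nat.mul_le_mul_right K hb
    nlinarith
  let f : Fin m → Fin (n + 1) := fun k => ⟨K * b + (k.val * p + v.val), hbound k⟩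
  have hcard : (univ : Finset (Fin m)).card = m := by simp
  rw [← hcard]
  refine Finset.card_le_card_of_injOn f ?_ ?_
  · intro k _
    rw [mem_coe, mem_filter]
    refine ⟨mem_univ _, ?_, ?_⟩
    · show (K * b + (k.val * p + v.val)) / K = b
      have h1 : k.val * p + v.val < K := by
        have : (k.val + 1) * p ≤ m * p := Nat.mul_le_mul_right p (by have := k.isLt; omega)
        rw [hKm]; nlinarith
      rw [Nat.mul_add_div hK0, Nat.div_eq_of_lt h1, add_zero]
    · show (((K * b + (k.val * p + v.val) : ℕ)) : ZMod p) = v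
      rw [hKm]; push_cast
      rw [ZMod.natCast_self, zero_mul, zero_mul, mul_zero, zero_add, zero_add, ZMod.natCast_zmod_val]
  · intro k _ k' _ hkk
    have h1 : K * b + (k.val * p + v.val) = K * b + (k'.val * p + v.val) := by
      have := congrArg Fin.val hkk
      simpa [f] using this
    exact Fin.ext (Nat.eq_of_mul_eq_mul_right hp0 (by omega))

/-- **swap mass of the comb family**: every position with a right neighbour has `2·swapMass ≥ dialM n · 2ⁿ`. -/
theorem swapMass_combY_ge [hp : Fact p.Prime] (hB2 : 2 ≤ combB p n) (s t : Fin n) (hst : t.val = s.val + 1) :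
    dialM n * 2 ^ n ≤ 2 * swapMass (combY p n) s.val := by
  have hst' : s ≠ t := fun h => by rw [h] at hst; omega
  set m := dialM n
  set B := combB p n with hB
  set K := combK p n with hK
  set b := s.val % B with hb
  have hbB : b < B := Nat.mod_lt _ (by omega)
  have hK0 : 0 < K := combK_pos n
  set A := univ.filter fun u : Fin n → Bool => u s ≠ u t
  let P : Fin (n + 1) → (Fin n → Bool) → Prop := fun g u =>
    u s ≠ u t ∧ (g.val / K = b ∧ ((g : ℕ) : ZMod p) = form (combCoef p B b) u)
  have hcut : ∀ g : Fin (n + 1), (univ.filter fun u => P g u).card ≤ swapInf (combY p n) g s.val := by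
    intro g
    refine card_le_card fun u hu => ?_
    rcases mem_filter.1 hu with ⟨-, hne, hgK, hform⟩
    have hgB : g.val < B * K := by
      have h1 : g.val < g.val / K * K + K := Nat.lt_div_mul_add hK0
      rw [hgK] at h1
      have h2 : (b + 1) * K ≤ B * K := Nat.mul_le_mul_right K hbB
      nlinarith
    exact mem_filter.2 ⟨mem_univ _, (neAdj_iff u _).2 ⟨s, t, rfl, hst, hne⟩, combY_flip hB2 g u s t hst hne hgK hgB hform⟩
  have hx : m * A.card ≤ ∑ g : Fin (n + 1), (univ.filter fun u => P g u).card := by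
    have hrw : ∀ g : Fin (n + 1), (univ.filter fun u => P g u).card = ∑ u : Fin n → Bool, if P g u then 1 else 0 := by
      intro g; rw [card_filter]
    simp_rw [hrw]
    rw [Finset.sum_comm]
    have hA : m * A.card = ∑ u : Fin n → Bool, if u s ≠ u t then m else 0 := by
      rw [← Finset.sum_filter, sum_const, smul_eq_mul, mul_comm]
    rw [hA]
    refine sum_le_sum fun u _ => ?_
    by_cases hu : u s ≠ u t
    · rw [if_pos hu]
      have : ∑ g : Fin (n + 1), (if P g u then 1 else 0) =
          (univ.filter fun g : Fin (n + 1) => g.val / K = b ∧ ((g : ℕ) : ZMod p) = form (combCoef p B b) u).card := by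
        rw [card_filter]
        refine sum_congr rfl fun g _ => ?_
        simp [P, hu]
      rw [this]
      exact card_cuts_comb_ge hbB _
    · rw [if_neg hu]
      exact Nat.zero_le _
  have hA2 := two_pow_le_two_mul_card_ne s t hst'
  have hmass : ∑ g : Fin (n + 1), (univ.filter fun u => P g u).card ≤ swapMass (combY p n) s.val := by
    unfold swapMass
    exact sum_le_sum fun g _ => hcut g
  calc m * 2 ^ n ≤ m * (2 * A.card) := Nat.mul_le_mul_left m hA2
    _ = 2 * (m * A.card) := by ring
    _ ≤ 2 * swapMass (combY p n) s.val := Nat.mul_le_mul_left 2 (le_trans hx hmass)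

/-- **the comb family is on the HIGH side** of the variation dial at threshold `4(log₂ n + 1)` (two blocks, `n ≥ 3`): at most one position is low. -/
theorem not_low_combY [hp : Fact p.Prime] (hn : 3 ≤ n) (hB2 : 2 ≤ combB p n) :
    ¬ (n ≤ 2 * (lowPositions n (combY p n) (4 * (Nat.log 2 n + 1))).card) := by
  intro hlow
  have hsub : lowPositions n (combY p n) (4 * (Nat.log 2 n + 1)) ⊆ {n - 1} := by
    intro i hi
    rcases mem_filter.1 hi with ⟨hir, hmass⟩
    rw [mem_range] at hir
    rw [mem_singleton]
    by_contra hne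
    have hi1 : i + 1 < n := by omega
    have h := swapMass_combY_ge (n := n) hB2 ⟨i, by omega⟩ ⟨i + 1, hi1⟩ rfl
    rw [dialM_eq] at h
    have h2n : 0 < 2 ^ n := Nat.two_pow_pos n
    have : (2 * (4 * (Nat.log 2 n + 1)) + 1) * 2 ^ n ≤ 2 * (4 * (Nat.log 2 n + 1) * 2 ^ n) :=
      le_trans h (Nat.mul_le_mul_left 2 hmass)
    nlinarith
  have := card_le_card hsub
  rw [card_singleton] at this
  omega

end Summit.QuantumAdvantage.AdviceFreeQNC0.JLinPeel.SegMove
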